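import Summits.Ventures.PercRepro.FrozenAD
import Summits.Ventures.PercRepro.Graph

/-!
# Freezing the clusters of two vertices: a four-vertex correlation inequality

For a finite multigraph `G`, two vertices `s, t` and four marked vertices `m, m', m'', m'''`
(`prob` is the product Bernoulli law with edge probabilities `p ∈ [0,1]^E`; `~` is connection by
open edges):

  `P(s ~ m, t ~ m', m'' ~ m''', m ≁ m', m ≁ m'', m' ≁ m'') · P(m ~ m'', m' ~ m''', m ≁ m' ∨ m ~ m''', m' ~ m'', m ≁ m')`
  `≤ P(m ~ m' ~ m'' ~ m''') · P(s ~ m, t ~ m', the four marked vertices pairwise disconnected)`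

(`cluster_freeze_ineq`).  In words: a configuration whose marked partition is `m | m' | m''m'''`
with `s` in the cluster of `m` and `t` in the cluster of `m'`, paired with a configuration in one
of the two crossing partitions that separate `m` from `m'`, is dominated by a configuration in
which all four are connected paired with one in which they are pairwise separated and `s ~ m`,
`t ~ m'` still hold.  Instantiated with `s, t` the endpoints of an edge `e` and the law on the
other edges, the left side is (the type-`(m, m')` part of) the cross term of the edge induction
for the crossing pair-sum conjecture C-005 (`proofs/P5-C005-cert.md` §6).

Proof: freeze the clusters of `s` and `t`.  Group the configurations `ω` of the first event by
the set `G.frozen ω s t` of edges touching `C(s) ∪ C(t)` (`prob_eq_sum_fiber`) and apply the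
frozen Ahlswede–Daykin inequality (`prob_mul_prob_le_of_meetOff_joinOff`) fibre by fibre: the
configuration `meetOff F ω ω'` keeps the clusters of `s, t` from `ω` (their internal edges lie in
`F`) and separates everything outside them (the meet with `ω'`), while `joinOff F ω ω' ≥ ω'`
inherits the two crossing connections from `ω'` and the connection `m'' ~ m'''` from `ω` (whose
path avoids the frozen clusters).
-/

namespace PercRepro

open Finset

variable {E : Type*}

/-- `meetOff K ω ω' ≤ ω`. -/
theorem meetOff_le_left [DecidableEq E] (K : Finset E) (ω ω' : Config E) :
    meetOff K ω ω' ≤ ω := by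
  intro f
  by_cases hf : f ∈ K
  · simp [meetOff, hf]
  · simp only [meetOff, hf, if_false]
    cases ω f <;> cases ω' f <;> simp

/-- `ω' ≤ joinOff K ω ω'`. -/
theorem le_joinOff_right [DecidableEq E] (K : Finset E) (ω ω' : Config E) :
    ω' ≤ joinOff K ω ω' := by
  intro f
  by_cases hf : f ∈ K
  · simp [joinOff, hf]
  · simp only [joinOff, hf, if_false]
    cases ω f <;> cases ω' f <;> simp

namespace MultiGraph

variable {V : Type*} (G : MultiGraph V E)

/-! ### The two clusters and the edges touching them -/

/-- The union of the open clusters of `s` and `t`. -/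
def twoClusters (ω : Config E) (s t : V) : Set V := G.cluster ω s ∪ G.cluster ω t

/-- `twoClusters` is closed under connection. -/
theorem mem_twoClusters_of_conn {ω : Config E} {s t a b : V} (ha : a ∈ G.twoClusters ω s t)
    (hab : G.Conn ω a b) : b ∈ G.twoClusters ω s t := by
  rcases ha with h | h
  · exact Or.inl (Conn.trans h hab)
  · exact Or.inr (Conn.trans h hab)

/-- `s` lies in `twoClusters ω s t`. -/
theorem left_mem_twoClusters (ω : Config E) (s t : V) : s ∈ G.twoClusters ω s t :=
  Or.inl (G.self_mem_cluster ω s)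

/-- `t` lies in `twoClusters ω s t`. -/
theorem right_mem_twoClusters (ω : Config E) (s t : V) : t ∈ G.twoClusters ω s t :=
  Or.inr (G.self_mem_cluster ω t)

variable [Fintype E]

open Classical in
/-- The edges with an endpoint in the clusters of `s` or `t`: the frozen edge set of `ω`. -/
noncomputable def frozen (ω : Config E) (s t : V) : Finset E :=
  univ.filter fun e => G.fst e ∈ G.twoClusters ω s t ∨ G.snd e ∈ G.twoClusters ω s t

/-- Membership in the frozen edge set. -/
theorem mem_frozen_iff {ω : Config E} {s t : V} {e : E} :
    e ∈ G.frozen ω s t ↔ G.fst e ∈ G.twoClusters ω s t ∨ G.snd e ∈ G.twoClusters ω s t := by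
  simp [frozen]

omit [Fintype E] in
/-- An edge with an endpoint in `twoClusters` that is open in `ω` has both endpoints there. -/
theorem mem_twoClusters_iff_of_open {ω : Config E} {s t : V} {e : E} (he : ω e = true) :
    G.fst e ∈ G.twoClusters ω s t ↔ G.snd e ∈ G.twoClusters ω s t := by
  have h := G.openAdj_of_open e he
  exact ⟨fun h1 => G.mem_twoClusters_of_conn h1 (Conn.of_openAdj h),
    fun h2 => G.mem_twoClusters_of_conn h2 (Conn.of_openAdj h.symm)⟩

variable [DecidableEq E]

/-! ### Connectivity in `meetOff` and `joinOff` over the frozen edge set -/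

/-- Connections from a vertex of the frozen clusters survive in `meetOff`: the edges of the open
path lie in the frozen set, where `meetOff` agrees with `ω`. -/
theorem conn_meetOff_of_conn {ω ω' : Config E} {s t u v : V}
    (hu : u ∈ G.twoClusters ω s t) (huv : G.Conn ω u v) :
    G.Conn (meetOff (G.frozen ω s t) ω ω') u v := by
  refine Conn.induction (Conn.refl G _ u) (fun {a b} hua hab ih => ?_) huv
  obtain ⟨e, he, hend⟩ := hab
  have ha : a ∈ G.twoClusters ω s t := G.mem_twoClusters_of_conn hu hua
  have heF : e ∈ G.frozen ω s t := by
    rw [mem_frozen_iff]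
    rcases hend with ⟨rfl, _⟩ | ⟨_, rfl⟩
    · exact Or.inl ha
    · exact Or.inr ha
  have he' : meetOff (G.frozen ω s t) ω ω' e = true := by
    simp [meetOff, heF, he]
  exact ih.trans (Conn.of_openAdj ⟨e, he', hend⟩)

/-- Connections in `meetOff` starting outside the frozen clusters stay outside them and are
connections of `ω'`. -/
theorem notMem_and_conn_of_conn_meetOff {ω ω' : Config E} {s t u v : V}
    (hu : u ∉ G.twoClusters ω s t) (huv : G.Conn (meetOff (G.frozen ω s t) ω ω') u v) :
    v ∉ G.twoClusters ω s t ∧ G.Conn ω' u v := by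
  refine Conn.induction (motive := fun b => b ∉ G.twoClusters ω s t ∧ G.Conn ω' u b)
    ⟨hu, Conn.refl G _ u⟩ (fun {a b} _ hab ih => ?_) huv
  obtain ⟨ha, hua⟩ := ih
  obtain ⟨e, he, hend⟩ := hab
  by_cases heF : e ∈ G.frozen ω s t
  · exfalso
    have he' : ω e = true := by simpa [meetOff, heF] using he
    have hiff := G.mem_twoClusters_iff_of_open (s := s) (t := t) he'
    rw [mem_frozen_iff] at heF
    rcases hend with ⟨rfl, rfl⟩ | ⟨rfl, rfl⟩
    · exact ha (heF.elim id hiff.2)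
    · exact ha (heF.elim hiff.1 id)
  · have he' : ω' e = true := by
      simp only [meetOff, heF, if_false, Bool.and_eq_true] at he
      exact he.2
    refine ⟨fun hb => heF ?_, hua.trans (Conn.of_openAdj ⟨e, he', hend⟩)⟩
    rw [mem_frozen_iff]
    rcases hend with ⟨_, rfl⟩ | ⟨rfl, _⟩
    · exact Or.inr hb
    · exact Or.inl hb

/-- Connections of `ω` starting outside the frozen clusters survive in `joinOff`: the open path
avoids the frozen set, where `joinOff` is the join. -/
theorem conn_joinOff_of_conn_notMem {ω ω' : Config E} {s t u v : V}
    (hu : u ∉ G.twoClusters ω s t) (huv : G.Conn ω u v) :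
    G.Conn (joinOff (G.frozen ω s t) ω ω') u v := by
  refine (Conn.induction (motive := fun b => b ∉ G.twoClusters ω s t ∧
    G.Conn (joinOff (G.frozen ω s t) ω ω') u b)
    ⟨hu, Conn.refl G _ u⟩ (fun {a b} _ hab ih => ?_) huv).2
  obtain ⟨ha, hua⟩ := ih
  obtain ⟨e, he, hend⟩ := hab
  have hiff := G.mem_twoClusters_iff_of_open (s := s) (t := t) he
  have hb : b ∉ G.twoClusters ω s t := by
    rcases hend with ⟨rfl, rfl⟩ | ⟨rfl, rfl⟩
    · exact fun h => ha (hiff.2 h)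
    · exact fun h => ha (hiff.1 h)
  have heF : e ∉ G.frozen ω s t := by
    rw [mem_frozen_iff]
    rcases hend with ⟨rfl, rfl⟩ | ⟨rfl, rfl⟩
    · exact fun h => h.elim ha hb
    · exact fun h => h.elim hb ha
  have he' : joinOff (G.frozen ω s t) ω ω' e = true := by
    simp [joinOff, heF, he]
  exact ⟨hb, hua.trans (Conn.of_openAdj ⟨e, he', hend⟩)⟩

/-- The clusters of `s` and `t` are unchanged by `meetOff` over the frozen set. -/
theorem twoClusters_meetOff (ω ω' : Config E) (s t : V) :
    G.twoClusters (meetOff (G.frozen ω s t) ω ω') s t = G.twoClusters ω s t := by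
  ext v
  constructor
  · rintro (h | h)
    · exact Or.inl (Conn.mono (meetOff_le_left _ ω ω') h)
    · exact Or.inr (Conn.mono (meetOff_le_left _ ω ω') h)
  · rintro (h | h)
    · exact Or.inl (G.conn_meetOff_of_conn (G.left_mem_twoClusters ω s t) h)
    · exact Or.inr (G.conn_meetOff_of_conn (G.right_mem_twoClusters ω s t) h)

omit [DecidableEq E] in
/-- The frozen edge set only depends on the two clusters. -/
theorem frozen_congr {ω₁ ω₂ : Config E} (s t : V)
    (h : G.twoClusters ω₁ s t = G.twoClusters ω₂ s t) : G.frozen ω₁ s t = G.frozen ω₂ s t := by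
  unfold frozen
  rw [h]

/-- The frozen edge set is unchanged by `meetOff` over itself. -/
theorem frozen_meetOff (ω ω' : Config E) (s t : V) :
    G.frozen (meetOff (G.frozen ω s t) ω ω') s t = G.frozen ω s t :=
  G.frozen_congr s t (G.twoClusters_meetOff ω ω' s t)

/-! ### The inequality -/

/-- **Freezing the clusters of two vertices.** For any vertices `s, t, m, m', m'', m'''`,
`P(s~m, t~m', m''~m''', m≁m', m≁m'', m'≁m'') · P((m~m'' ∧ m'~m''' ∧ m≁m') ∨ (m~m''' ∧ m'~m'' ∧ m≁m'))
≤ P(m~m' ∧ m'~m'' ∧ m''~m''') · P(s~m, t~m', the four pairwise disconnected)`. -/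
theorem cluster_freeze_ineq {p : E → ℝ} (hp : IsProb p) (s t m m' m'' m''' : V) :
    prob p {ω | G.Conn ω s m ∧ G.Conn ω t m' ∧ G.Conn ω m'' m''' ∧ ¬ G.Conn ω m m' ∧
        ¬ G.Conn ω m m'' ∧ ¬ G.Conn ω m' m''} *
      prob p ({ω | G.Conn ω m m'' ∧ G.Conn ω m' m''' ∧ ¬ G.Conn ω m m'} ∪
        {ω | G.Conn ω m m''' ∧ G.Conn ω m' m'' ∧ ¬ G.Conn ω m m'}) ≤
    prob p {ω | G.Conn ω m m' ∧ G.Conn ω m' m'' ∧ G.Conn ω m'' m'''} *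
      prob p {ω | G.Conn ω s m ∧ G.Conn ω t m' ∧ ¬ G.Conn ω m m' ∧ ¬ G.Conn ω m m'' ∧
        ¬ G.Conn ω m m''' ∧ ¬ G.Conn ω m' m'' ∧ ¬ G.Conn ω m' m''' ∧ ¬ G.Conn ω m'' m'''} := by
  classical
  set Ar : Set (Config E) := {ω | G.Conn ω s m ∧ G.Conn ω t m' ∧ G.Conn ω m'' m''' ∧
    ¬ G.Conn ω m m' ∧ ¬ G.Conn ω m m'' ∧ ¬ G.Conn ω m' m''} with hAr
  set Ac : Set (Config E) := {ω | G.Conn ω m m'' ∧ G.Conn ω m' m''' ∧ ¬ G.Conn ω m m'} ∪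
    {ω | G.Conn ω m m''' ∧ G.Conn ω m' m'' ∧ ¬ G.Conn ω m m'} with hAc
  set Top : Set (Config E) := {ω | G.Conn ω m m' ∧ G.Conn ω m' m'' ∧ G.Conn ω m'' m'''} with hTop
  set Ab : Set (Config E) := {ω | G.Conn ω s m ∧ G.Conn ω t m' ∧ ¬ G.Conn ω m m' ∧
    ¬ G.Conn ω m m'' ∧ ¬ G.Conn ω m m''' ∧ ¬ G.Conn ω m' m'' ∧ ¬ G.Conn ω m' m''' ∧
    ¬ G.Conn ω m'' m'''} with hAb
  rw [prob_eq_sum_fiber p (fun ω => G.frozen ω s t) Ar,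
    prob_eq_sum_fiber p (fun ω => G.frozen ω s t) Ab, Finset.sum_mul, Finset.mul_sum]
  refine Finset.sum_le_sum fun F _ => ?_
  rw [mul_comm (prob p Top)]
  refine prob_mul_prob_le_of_meetOff_joinOff hp F fun ω ω' hω hω' => ?_
  obtain ⟨⟨hsm, htm', hm''m''', hmm', hmm'', hm'm''⟩, hF⟩ := hω
  have hF' : G.frozen ω s t = F := hF
  subst hF'
  -- the marked vertices `m''`, `m'''` lie outside the frozen clusters
  have hm''X : m'' ∉ G.twoClusters ω s t := by
    rintro (h | h)
    · exact hmm'' (hsm.symm.trans h)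
    · exact hm'm'' (htm'.symm.trans h)
  -- `m'' ≁ m'''` in `ω'`, in both crossing cases
  have hω'sep : ¬ G.Conn ω' m'' m''' := by
    rcases hω' with ⟨h1, h2, h3⟩ | ⟨h1, h2, h3⟩
    · exact fun h => h3 (h1.trans (h.trans h2.symm))
    · exact fun h => h3 (h1.trans (h.symm.trans h2.symm))
  have hle := meetOff_le_left (G.frozen ω s t) ω ω'
  refine ⟨⟨⟨G.conn_meetOff_of_conn (G.left_mem_twoClusters ω s t) hsm,
    G.conn_meetOff_of_conn (G.right_mem_twoClusters ω s t) htm', ?_, ?_, ?_, ?_, ?_, ?_⟩,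
    G.frozen_meetOff ω ω' s t⟩, ?_⟩
  · exact fun h => hmm' (Conn.mono hle h)
  · exact fun h => hmm'' (Conn.mono hle h)
  · exact fun h => hmm'' ((Conn.mono hle h).trans hm''m'''.symm)
  · exact fun h => hm'm'' (Conn.mono hle h)
  · exact fun h => hm'm'' ((Conn.mono hle h).trans hm''m'''.symm)
  · exact fun h => hω'sep (G.notMem_and_conn_of_conn_meetOff hm''X h).2
  · -- `joinOff` is in `Top`
    have hge := le_joinOff_right (G.frozen ω s t) ω ω'
    have h23 : G.Conn (joinOff (G.frozen ω s t) ω ω') m'' m''' :=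
      G.conn_joinOff_of_conn_notMem hm''X hm''m'''
    rcases hω' with ⟨h1, h2, _⟩ | ⟨h1, h2, _⟩
    · have h1' := Conn.mono hge h1
      have h2' := Conn.mono hge h2
      exact ⟨h1'.trans (h23.trans h2'.symm), h2'.trans (h23.symm), h23⟩
    · have h1' := Conn.mono hge h1
      have h2' := Conn.mono hge h2
      exact ⟨h1'.trans (h23.symm.trans h2'.symm), h2', h23⟩

end MultiGraph

end PercRepro
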